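import Literature.Combinatorics.Enumerative.DurfeeSquareIdentity
import Literature.Combinatorics.Enumerative.PartitionGeneratingFunctionAnalytic
import Mathlib.Analysis.Normed.Ring.InfiniteSum
import Mathlib.Topology.Algebra.InfiniteSum.Real

/-!
# Euler's Durfee-square identity at a point (Hardy–Wright Theorem 351, `|x| < 1`)

Hardy–Wright, *An Introduction to the Theory of Numbers*, §19.7, Theorem 351:

> `1/((1−x)(1−x²)(1−x³)…) = 1 + x/(1−x)² + x⁴/((1−x)²(1−x²)²) + x⁹/((1−x)²(1−x²)²(1−x³)²) + …`

(the Durfee square of side `i` accounts for `x^{i²}`, the two tails for the squared denominators;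
«And hence the total number of partitions of `n` is the coefficient of `xⁿ` in the expansion» of the
right-hand side). As everywhere in Chapter XIX the identity is meant for `|x| < 1` (§19.3).

The tree proves Theorem 351 for formal power series (`DurfeeSquareIdentity`: `hasSum_durfee`,
`hasSum_durfee_card_partition`, and the coefficient form `card_partition_eq_sum_coeff`). Here it is
deduced **at a point** `x` of a complete normed field with `‖x‖ < 1`, as for the Rogers–Ramanujan
identities:

* the coefficient identity `p(n) = Σ_{i² ≤ n} Σ_{a+b = n−i²} p(a ∣ parts ≤ i) p(b ∣ parts ≤ i)`
  (`card_partition_eq_sum_sum_card_restricted`, from the tree's coefficient form);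
* `x^{i²}/((1−x)²⋯(1−xⁱ)²) = Σ_n a_i(n) xⁿ` with these coefficients, by the Cauchy product of two
  copies of (19.3.2) at a point (`PartitionGeneratingFunctionAnalytic`);
* the absolutely convergent double series summed both ways (`HasSum.prod_fiberwise`).

## Main statements (`‖x‖ < 1`)

* `card_partition_eq_sum_sum_card_restricted` — the coefficient identity;
* `hasSum_sq_mul_prod_inv_sq_tsum` — `Σ_i x^{i²} (∏_{k<i} (1 − x^{k+1})⁻¹)² = Σ_n p(n) xⁿ`;
* `hasSum_durfee` — **Theorem 351 at a point**:
  `Σ_i x^{i²} (∏_{k<i} (1 − x^{k+1})⁻¹)² = ∏_k (1 − x^{k+1})⁻¹`, and `tsum_durfee_eq_tprod`.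

## References
* [HardyWright2008] G. H. Hardy, E. M. Wright, *An Introduction to the Theory of Numbers*, 6th ed.
  (OUP 2008), §19.7 Theorem 351; §19.3.
* [AndrewsEriksson2004] G. E. Andrews, K. Eriksson, *Integer Partitions*, §8.1 (8.2) (the formal
  proof in the tree).
-/

noncomputable section

open Finset Filter Topology PowerSeries Nat.Partition
open Literature.Combinatorics.Enumerative.PartitionGenFunAnalytic
open Literature.Combinatorics.Enumerative.DurfeeSquare

namespace Literature.Combinatorics.Enumerative.DurfeeSquareAnalytic

/-! ### §1. The coefficient identity behind Theorem 351 -/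

section Coefficients

open PowerSeries.WithPiTopology

/-- `∏_{t<i} Σ_j X^{(t+1)j} = Σ_n p(n ∣ parts ≤ i) Xⁿ` in `ℝ⟦X⟧`. [folklore] -/
private theorem prod_geom_eq_mk (i : ℕ) :
    ∏ t ∈ range i, ∑' j, (X : ℝ⟦X⟧) ^ ((t + 1) * j) =
      PowerSeries.mk fun n ↦ (#(restricted n (· ≤ i)) : ℝ) := by
  rw [Nat.Partition.powerSeriesMk_card_restricted_eq_tprod ℝ (· ≤ i),
    tprod_eq_prod (s := range i) (fun t ht ↦ by
      rw [mem_range, not_lt] at ht; rw [if_neg (by simpa using ht)])]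
  exact prod_congr rfl fun t ht ↦ by rw [mem_range] at ht; rw [if_pos (by simpa using ht)]

/-- The coefficient of `xⁿ` in `x^{i²} (∏_{t<i} Σ_j x^{(t+1)j})²`:
`Σ_{a+b = n−i²} p(a ∣ parts ≤ i) p(b ∣ parts ≤ i)` (`0` if `n < i²`). [folklore] -/
private theorem coeff_term (i n : ℕ) :
    coeff n ((X : ℝ⟦X⟧) ^ (i * i) * ∏ t ∈ range i, (∑' j, (X : ℝ⟦X⟧) ^ ((t + 1) * j)) ^ 2) =
      if i * i ≤ n then ((∑ p ∈ antidiagonal (n - i * i),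
        #(restricted p.1 (· ≤ i)) * #(restricted p.2 (· ≤ i)) : ℕ) : ℝ) else 0 := by
  rw [prod_pow, prod_geom_eq_mk, coeff_X_pow_mul']
  split_ifs with h
  · rw [sq, coeff_mul]
    push_cast
    simp only [coeff_mk]
  · rfl

/-- **The coefficient identity of Theorem 351** («the total number of partitions of `n` is the
coefficient of `xⁿ`» in the Durfee expansion): `p(n) = Σ_{i² ≤ n} Σ_{a+b = n−i²} p(a ∣ ≤ i) p(b ∣ ≤ i)`.
[cite: HardyWright2008, §19.7 Thm 351] -/
theorem card_partition_eq_sum_sum_card_restricted (n : ℕ) :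
    Fintype.card n.Partition = ∑ i ∈ range (n + 1), (if i * i ≤ n then
      ∑ p ∈ antidiagonal (n - i * i), #(restricted p.1 (· ≤ i)) * #(restricted p.2 (· ≤ i)) else 0) := by
  have h := card_partition_eq_sum_coeff ℝ n
  simp only [coeff_term] at h
  exact_mod_cast h

end Coefficients

/-! ### §2. The terms `x^{i²}/((1−x)²⋯(1−xⁱ)²)` as power series in `x` -/

section Analytic

variable {𝕜 : Type*} [NormedField 𝕜] [CompleteSpace 𝕜]

/-- `x^{i²}/((1−x)²(1−x²)²⋯(1−xⁱ)²) = Σ_n a_i(n) xⁿ` for `‖x‖ < 1`, with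
`a_i(n) = Σ_{a+b = n−i²} p(a ∣ parts ≤ i) p(b ∣ parts ≤ i)` — the Cauchy square of (19.3.2) at a point,
shifted by `i²`. [cite: HardyWright2008, §19.7 Thm 351] -/
theorem hasSum_term {x : 𝕜} (hx : ‖x‖ < 1) (i : ℕ) :
    HasSum (fun n ↦ (if i * i ≤ n then ((∑ p ∈ antidiagonal (n - i * i),
        #(restricted p.1 (· ≤ i)) * #(restricted p.2 (· ≤ i)) : ℕ) : 𝕜) else 0) * x ^ n)
      (x ^ (i * i) * (∏ k ∈ range i, (1 - x ^ (k + 1))⁻¹) ^ 2) := by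
  -- the series `Σ_n p(n ∣ ≤ i) xⁿ` and its Cauchy square
  set f : ℕ → 𝕜 := fun n ↦ (#(restricted n (· ≤ i)) : 𝕜) * x ^ n with hf
  have hfs : HasSum f (∏ k ∈ range i, (1 - x ^ (k + 1))⁻¹) := hasSum_card_restricted_le_mul_pow hx i
  have hfn : Summable fun n ↦ ‖f n‖ := by
    refine Summable.of_nonneg_of_le (fun n ↦ norm_nonneg _) (fun n ↦ ?_)
      (summable_card_partition_mul_pow_real (norm_nonneg x) hx)
    rw [hf, norm_mul, norm_pow]
    have h1 : ‖(#(restricted n (· ≤ i)) : 𝕜)‖ ≤ #(restricted n (· ≤ i)) := by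
      simpa using Nat.norm_cast_le (α := 𝕜) (#(restricted n (· ≤ i)))
    exact mul_le_mul_of_nonneg_right
      (h1.trans (by exact_mod_cast card_restricted_le_card_univ (· ≤ i) n)) (pow_nonneg (norm_nonneg x) n)
  have hsq : HasSum (fun n ↦ ∑ p ∈ antidiagonal n, f p.1 * f p.2)
      ((∏ k ∈ range i, (1 - x ^ (k + 1))⁻¹) ^ 2) := by
    have hs : Summable fun n ↦ ∑ p ∈ antidiagonal n, f p.1 * f p.2 :=
      (summable_norm_sum_mul_antidiagonal_of_summable_norm hfn hfn).of_norm
    have ht := tsum_mul_tsum_eq_tsum_sum_antidiagonal_of_summable_norm hfn hfn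
    rw [hfs.tsum_eq, ← sq] at ht
    rw [ht]
    exact hs.hasSum
  -- the antidiagonal sums are `(Σ_{a+b=n} p(a)p(b)) xⁿ`
  have hanti : ∀ n, ∑ p ∈ antidiagonal n, f p.1 * f p.2 =
      ((∑ p ∈ antidiagonal n, #(restricted p.1 (· ≤ i)) * #(restricted p.2 (· ≤ i)) : ℕ) : 𝕜) * x ^ n := by
    intro n
    push_cast
    rw [sum_mul]
    refine sum_congr rfl fun p hp ↦ ?_
    rw [hf]
    dsimp only
    rw [← mem_antidiagonal.mp hp, pow_add]
    ring
  simp_rw [hanti] at hsq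
  -- shift by `i²`
  have h := hsq.mul_left (x ^ (i * i))
  have hinj : Function.Injective fun n : ℕ ↦ n + i * i := add_left_injective _
  have hcomp : ((fun n ↦ (if i * i ≤ n then ((∑ p ∈ antidiagonal (n - i * i),
        #(restricted p.1 (· ≤ i)) * #(restricted p.2 (· ≤ i)) : ℕ) : 𝕜) else 0) * x ^ n) ∘
        fun n : ℕ ↦ n + i * i) =
      fun n ↦ x ^ (i * i) * (((∑ p ∈ antidiagonal n,
        #(restricted p.1 (· ≤ i)) * #(restricted p.2 (· ≤ i)) : ℕ) : 𝕜) * x ^ n) := by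
    funext n
    have hn : n + i * i - i * i = n := Nat.add_sub_cancel _ _
    simp only [Function.comp_apply, le_add_iff_nonneg_left, zero_le, if_true, pow_add]
    rw [hn]
    ring
  have h0 : ∀ n ∉ Set.range (fun n : ℕ ↦ n + i * i),
      (if i * i ≤ n then ((∑ p ∈ antidiagonal (n - i * i),
        #(restricted p.1 (· ≤ i)) * #(restricted p.2 (· ≤ i)) : ℕ) : 𝕜) else 0) * x ^ n = 0 := by
    intro n hn
    rw [if_neg, zero_mul]
    intro hin
    exact hn ⟨n - i * i, show n - i * i + i * i = n by omega⟩
  rw [← hinj.hasSum_iff h0, hcomp]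
  exact h

/-- Summing a double series by rows and by columns: if `Σ_{s ≤ n} a(s, n) = b(n)`, `a(s, n) = 0` for
`n < s`, `Σ_n b(n)|x|ⁿ < ∞`, and `T(s) = Σ_n a(s, n) xⁿ`, then `Σ_s T(s) = Σ_n b(n) xⁿ`. [folklore] -/
private theorem hasSum_of_coeff_identity {a : ℕ → ℕ → ℕ} {b : ℕ → ℕ} {T : ℕ → 𝕜} {x : 𝕜}
    (hfin : ∀ s n, n < s → a s n = 0) (hcoeff : ∀ n, ∑ s ∈ range (n + 1), a s n = b n)
    (hb : Summable fun n ↦ (b n : ℝ) * ‖x‖ ^ n)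
    (hT : ∀ s, HasSum (fun n ↦ (a s n : 𝕜) * x ^ n) (T s)) :
    HasSum T (∑' n, (b n : 𝕜) * x ^ n) := by
  set G : ℕ × ℕ → 𝕜 := fun p ↦ (a p.2 p.1 : 𝕜) * x ^ p.1 with hG
  have hGnorm : Summable fun p : ℕ × ℕ ↦ (a p.2 p.1 : ℝ) * ‖x‖ ^ p.1 := by
    refine (summable_prod_of_nonneg fun p ↦ by positivity).mpr ⟨fun n ↦ ?_, ?_⟩
    · exact summable_of_ne_finset_zero (s := range (n + 1)) fun s hs ↦ by
        rw [mem_range, not_lt] at hs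
        simp [hfin s n (by omega)]
    · refine hb.congr fun n ↦ ?_
      rw [tsum_eq_sum (s := range (n + 1)) fun s hs ↦ by
        rw [mem_range, not_lt] at hs
        simp [hfin s n (by omega)]]
      show ((b n : ℝ)) * ‖x‖ ^ n = ∑ s ∈ range (n + 1), (a s n : ℝ) * ‖x‖ ^ n
      rw [← sum_mul, ← Nat.cast_sum, hcoeff n]
  have hGsum : Summable G := .of_norm_bounded hGnorm fun p ↦ by
    rw [hG, norm_mul, norm_pow]
    have ha : ‖(a p.2 p.1 : 𝕜)‖ ≤ a p.2 p.1 := by simpa using Nat.norm_cast_le (α := 𝕜) (a p.2 p.1)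
    exact mul_le_mul_of_nonneg_right ha (pow_nonneg (norm_nonneg x) _)
  have hrow : HasSum (fun n ↦ (b n : 𝕜) * x ^ n) (∑' p, G p) := by
    refine hGsum.hasSum.prod_fiberwise fun n ↦ ?_
    have hfin' : HasSum (fun s ↦ (a s n : 𝕜) * x ^ n) (∑ s ∈ range (n + 1), (a s n : 𝕜) * x ^ n) :=
      hasSum_sum_of_ne_finset_zero fun s hs ↦ by
        rw [mem_range, not_lt] at hs
        simp [hfin s n (by omega)]
    rw [← sum_mul, ← Nat.cast_sum, hcoeff n] at hfin'
    exact hfin'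
  rw [hrow.tsum_eq]
  have hGsum' : Summable (G ∘ (Equiv.prodComm ℕ ℕ)) := (Equiv.prodComm ℕ ℕ).summable_iff.mpr hGsum
  have h2 : HasSum T (∑' p, (G ∘ (Equiv.prodComm ℕ ℕ)) p) :=
    hGsum'.hasSum.prod_fiberwise fun s ↦ by simpa [hG] using hT s
  have h3 : ∑' p, (G ∘ ⇑(Equiv.prodComm ℕ ℕ)) p = ∑' p, G p := (Equiv.prodComm ℕ ℕ).tsum_eq G
  rw [h3] at h2
  exact h2

/-- **Theorem 351 at a point, series form**: for `‖x‖ < 1`,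
`Σ_i x^{i²}/((1−x)²⋯(1−xⁱ)²) = Σ_n p(n) xⁿ`. [cite: HardyWright2008, §19.7 Thm 351] -/
theorem hasSum_sq_mul_prod_inv_sq_tsum {x : 𝕜} (hx : ‖x‖ < 1) :
    HasSum (fun i ↦ x ^ (i * i) * (∏ k ∈ range i, (1 - x ^ (k + 1))⁻¹) ^ 2)
      (∑' n, (Fintype.card (Nat.Partition n) : 𝕜) * x ^ n) := by
  have hb : Summable fun n ↦ ((Fintype.card (Nat.Partition n) : ℕ) : ℝ) * ‖x‖ ^ n :=
    summable_card_partition_mul_pow_real (norm_nonneg x) hx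
  refine hasSum_of_coeff_identity (a := fun i n ↦ if i * i ≤ n then
      ∑ p ∈ antidiagonal (n - i * i), #(restricted p.1 (· ≤ i)) * #(restricted p.2 (· ≤ i)) else 0)
    (fun i n hni ↦ ?_) (fun n ↦ (card_partition_eq_sum_sum_card_restricted n).symm) hb fun i ↦ ?_
  · have := Nat.le_mul_self i
    rw [if_neg (by nlinarith)]
  · simpa [Nat.cast_ite] using hasSum_term hx i

/-- **Hardy–Wright Theorem 351 (Euler) at a point**: for `‖x‖ < 1`,
`1/((1−x)(1−x²)(1−x³)…) = 1 + x/(1−x)² + x⁴/((1−x)²(1−x²)²) + x⁹/((1−x)²(1−x²)²(1−x³)²) + …`, the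
quotients read as `x^{i²} (∏_{k<i} (1 − x^{k+1})⁻¹)²`. [cite: HardyWright2008, §19.7 Thm 351] -/
theorem hasSum_durfee {x : 𝕜} (hx : ‖x‖ < 1) :
    HasSum (fun i ↦ x ^ (i * i) * (∏ k ∈ range i, (1 - x ^ (k + 1))⁻¹) ^ 2)
      (∏' k, ((1 : 𝕜) - x ^ (k + 1))⁻¹) := by
  rw [← tsum_card_partition_mul_pow_eq_tprod hx]
  exact hasSum_sq_mul_prod_inv_sq_tsum hx

/-- **Theorem 351** as an equation, `‖x‖ < 1`. [cite: HardyWright2008, §19.7 Thm 351] -/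
theorem tsum_durfee_eq_tprod {x : 𝕜} (hx : ‖x‖ < 1) :
    ∑' i, x ^ (i * i) * (∏ k ∈ range i, (1 - x ^ (k + 1))⁻¹) ^ 2 = ∏' k, ((1 : 𝕜) - x ^ (k + 1))⁻¹ :=
  (hasSum_durfee hx).tsum_eq

end Analytic

end Literature.Combinatorics.Enumerative.DurfeeSquareAnalytic
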